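import Summits.QuantumFields.YangMills.Theorems.BalabanUVNodesN15CovariantLandauNeumannRows
import HarnessLib

/-!
# Route «BalabanUVNodes», node N15 = NE2, road (c) — PROGRAMME (P-S), V: THE COVARIANT PROPAGATOR ROWS FROM THE FLAT ONES BY NEUMANN SERIES, II — the rows of `G′(T) − G′(1)`
# (n15-c∕212 `cGreen_sub_words`, every word a product of known rows) and of `(Q′G′²Q′ᵀ)⁻¹(T)` (the fixed point `S(T)⁻¹ = S(1)⁻¹ − S(1)⁻¹(S(T) − S(1))S(T)⁻¹` and
# `B11SectG.neumann_majorant`) (dag-n15-c g23, n15-c∕216)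

Cell `pub-ymgap`, seat `pub-ymgap-dag-n15-c` (generation g23; R134 (a), s1; HUMAN RULING D-0062; chair R424 venue).  `bears_on: R4∕N15 · K3⁸ SpineGivenEndpointR13SepCoPHV
(stmt-QuantumFields-27366)`; filed `--supports stmt-QuantumFields-27366 --as helper` — COUNT-NEUTRAL.  Theorems only; 0 `sorry`; NO estimate of Bałaban's (the flat rows, the row of
`G′(T)`, the gradient difference and the row of `S(T) − S(1)` are HYPOTHESES — the last two produced by n15-c∕215 ∕ n15-c∕214 from the same primitive data).  Imports BY NAME n15-c∕215
`…CovariantLandauNeumannRows` (`hasMaj_cgrad_sub`, `hasMaj_cgrad_sub_transpose`, `hasMaj_csavg_sub`, `hasMaj_csavg`, `stair_one_cols`, `mulVecLin_smul'`, `mulVecLin_sub'`; through it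
n15-c∕214 (`hasMaj_csavg_transpose`, `hasMaj_csavg_sub_transpose`, `mulVecLin_neg'`), n15-c∕212 (`cGreen_sub_words`, `cSop_inv_fixedPoint`), n15-c∕213 (`hasMaj_comp_localRight∕Left`),
dag-n15-a `hasMaj_smul_ofBlocks`, n15-b `exists_const_hasMaj_ofBlocks`∕`kappa_ofBlocks`, `B11SectG.neumann_majorant`∕`hasMaj_comp_exp`).  Nothing in the tree is modified.

WHY.  With n15-c∕215 (`G′(T)` from the flat rows) the two remaining covariant inputs of n15-c∕214 `hasMaj_landauCov_sub` that are NOT Schauder-type — `G′(T) − G′(1)` and `(Q′G′²Q′ᵀ)⁻¹(T)` —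
follow by the same mechanism ([Balaban1985BackgroundPropagators] Thm 3.4 p. 400 *«small perturbations of the operators depending on U only»*, expansion (3.50)–(3.53);
[Balaban1984PropagatorsII] (2.52)–(2.56); [Balaban1985Variational] (188)).  After this file the displayed primitive data of the Landau letter `N_V^R` are: the FOUR FLAT rows `G′(1)`,
`∂G′(1)`, `G′(1)∂ᵀ`, `(Q′G′²Q′ᵀ)⁻¹(1)` ([Balaban1984PropagatorsII] Props. 2.2–2.3), the ONE covariant gradient difference `D_TG′(T) − ∂G′(1)` (Thm 3.4), the transporter letters and
two smallness conditions.
* §1 ★★ `hasMaj_cGreen_sub_of_flat` — `G′(T) − G′(1) ≤ P_G·e^{−δ_Td}`, `P_G` explicit and `∝` the transporter letters `nρ`, `σ`, from the flat rows, the gradient difference and a row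
  of `G′(T)` at a rate `δ_T` with `δ_T + 2s ≤ δ`.
* §2 ★★ `hasMaj_cSop_inv_of_flat` — `(Q′G′²Q′ᵀ)⁻¹(T) ≤ C_S n^{d+1}(1 − C_SBc²)⁻¹e^{−(δ₁−2s)d}` from `(Q′G′²Q′ᵀ)⁻¹(1) ≤ C_S n^{d+1}e^{−δ₁d}`, a row `B·n^{−(d+1)}e^{−(δ₁−s)d}` of
  `S(T) − S(1)` (n15-c∕214 `hasMaj_cSop_sub_of`) and `C_SBc² < 1`.

HONEST FRAMING ∕ LIMITS.  Bookkeeping; hypotheses as listed; MODEL READING as n15-c∕197; NOT [Balaban1985BackgroundPropagators] Thms 3.1–3.4 as printed; NE2⁺ NOT PRINTED; N15 of record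
untouched (DISCHARGED AS CONSUMED, p687738); counts UNMOVED (typed 28∕28 · discharged 8∕27); one finite 𝕋⁴ at fixed ε per index — NOT infinite volume ∕ OS ∕ mass gap ∕ Clay.
Restate-immune (no Theses import).
-/

noncomputable section

open scoped BigOperators Matrix
open Finset

namespace Summit.QuantumFields.YangMills.BalabanUVNodes.N15.CovLandau

open Literature.MathematicalPhysics.QuantumFieldTheory.Balaban1983to89
open Literature.MathematicalPhysics.QuantumFieldTheory.Balaban1983to89.B5Prop11Plancherel (Tor fine unitVec)
open Literature.MathematicalPhysics.QuantumFieldTheory.Balaban1983to89.B11SectG (BlockNorm HasMaj RowSum hasMaj_comp_exp neumann_majorant)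
open Literature.MathematicalPhysics.QuantumFieldTheory.Balaban1983to89.B6UnitTorusCarrier (unitTorusGeo rowSum_unitTorusGeo triangle254_unitTorusGeo unitTorusGeo_dist_nonneg)
open Literature.MathematicalPhysics.QuantumFieldTheory.King1986.Torus (blockOf tdistT tdistT_nonneg)
open Summit.QuantumFields.YangMills.BalabanUVNodes.N15.MatrixSpecies (liftBlk)
open Summit.QuantumFields.YangMills.BalabanUVNodes.N15.CovAvg (cvaStair)
open Summit.QuantumFields.YangMills.BalabanUVNodes.N15.BackgroundModel (kappa_ofBlocks)
open Summit.QuantumFields.YangMills.BalabanUVNodes.N15.DerivDefect (exists_const_hasMaj_ofBlocks)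
open Summit.QuantumFields.YangMills.BalabanUVNodes.N15.TwoGrid (hasMaj_smul_ofBlocks)
open Summit.QuantumFields.YangMills.BalabanUVNodes.N15.BlockRows (hasMaj_comp_localRight hasMaj_comp_localLeft)

variable {d : ℕ} (M : Fin (d + 1) → ℕ) [∀ μ, NeZero (M μ)] (n : ℕ) [NeZero n] {ι : Type} [Fintype ι] [DecidableEq ι] (L k : ℕ)

/-! ## §1 `G′(T) − G′(1)` -/

section GreenSub

/-- ★★ **THE ROW OF `G′(T) − G′(1)`** — every word of n15-c∕212 `cGreen_sub_words` is a product of known rows: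
`−G′(1)(D_T−∂)ᵀ·D_TG′(T) − G′(1)∂ᵀ·(D_T−∂)G′(T) − a·G′(1)(Q′(T)−Q′(1))ᵀ·Q′(T)G′(T) − a·G′(1)Q′(1)ᵀ·(Q′(T)−Q′(1))G′(T)`; with the flat rows (`C_G`, `C_A`, `C_D` at rate `δ`), the gradient
difference (`P_D`), a row `C_T e^{−δ_Td}` of `G′(T)` (`δ_T + 2s ≤ δ`) and the transporter letters, `G′(T) − G′(1) ≤ P_G·e^{−δ_Td}` with
`P_G = C_G(d+1)nρe^{δ}(C_D+P_D)c² + C_A·nρe^{δ_T+s}C_Tc² + |a|n^{−(d+1)}C_GC_T(στ + σ)c` — proportional to the letters `nρ`, `σ`.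
[cite: Balaban1985BackgroundPropagators, Thm 3.4 p.400, (3.50)–(3.53) p.400 (mechanism); Balaban1984PropagatorsII, (2.52)–(2.56) pp.232–233] -/
theorem hasMaj_cGreen_sub_of_flat {T : Fin (d + 1) → Tor (fine n M) → Matrix ι ι ℝ} (hT : ∀ ν x, IsUnit (T ν x)) {a : ℝ} (ha : 0 < a)
    {δ δT s c CG CA CD PD CT ρ σ τ : ℝ} (hs : 0 < s) (hδT : 0 ≤ δT) (hδTδ : δT + 2 * s ≤ δ) (hrow : RowSum (unitTorusGeo L k M) s c) (hc : 0 ≤ c)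
    (hCG : 0 ≤ CG) (hCA : 0 ≤ CA) (hCD : 0 ≤ CD) (hPD : 0 ≤ PD) (hCT : 0 ≤ CT) (hρ0 : 0 ≤ ρ) (hσ0 : 0 ≤ σ) (hτ0 : 0 ≤ τ)
    (hρr : ∀ ν x i, ∑ j, |(T ν x - (fun (_ : Fin (d + 1)) (_ : Tor (fine n M)) => (1 : Matrix ι ι ℝ)) ν x) i j| ≤ ρ)
    (hρc : ∀ ν x j, ∑ i, |(T ν x - (fun (_ : Fin (d + 1)) (_ : Tor (fine n M)) => (1 : Matrix ι ι ℝ)) ν x) i j| ≤ ρ)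
    (hσr : ∀ y a' i, ∑ j, |(cvaStair M n (fun μ b => T μ b.1) y a' 0 - cvaStair M n (fun μ b => (fun (_ : Fin (d + 1)) (_ : Tor (fine n M)) => (1 : Matrix ι ι ℝ)) μ b.1) y a' 0) i j| ≤ σ)
    (hσc : ∀ y a' j, ∑ i, |(cvaStair M n (fun μ b => T μ b.1) y a' 0 - cvaStair M n (fun μ b => (fun (_ : Fin (d + 1)) (_ : Tor (fine n M)) => (1 : Matrix ι ι ℝ)) μ b.1) y a' 0) i j| ≤ σ)
    (hτr : ∀ y a' i, ∑ j, |cvaStair M n (fun μ b => T μ b.1) y a' 0 i j| ≤ τ)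
    (hG1 : HasMaj (BlockNorm.ofBlocks (unitTorusGeo L k M) (liftBlk (blockOf n M) ι)) (BlockNorm.ofBlocks (unitTorusGeo L k M) (liftBlk (blockOf n M) ι)) (Matrix.mulVecLin (cGreen M n (fun (_ : Fin (d + 1)) (_ : Tor (fine n M)) => (1 : Matrix ι ι ℝ)) a)) (fun y y' => CG * Real.exp (-(δ * tdistT M y y'))))
    (hA1 : HasMaj (BlockNorm.ofBlocks (unitTorusGeo L k M) (liftBlk (fun b : Tor (fine n M) × Fin (d + 1) => blockOf n M b.1) ι)) (BlockNorm.ofBlocks (unitTorusGeo L k M) (liftBlk (blockOf n M) ι)) (Matrix.mulVecLin (cGreen M n (fun (_ : Fin (d + 1)) (_ : Tor (fine n M)) => (1 : Matrix ι ι ℝ)) a * (cgrad M n (fun (_ : Fin (d + 1)) (_ : Tor (fine n M)) => (1 : Matrix ι ι ℝ)))ᵀ)) (fun y y' => CA * Real.exp (-(δ * tdistT M y y'))))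
    (hD1 : HasMaj (BlockNorm.ofBlocks (unitTorusGeo L k M) (liftBlk (blockOf n M) ι)) (BlockNorm.ofBlocks (unitTorusGeo L k M) (liftBlk (fun b : Tor (fine n M) × Fin (d + 1) => blockOf n M b.1) ι)) (Matrix.mulVecLin (cgrad M n (fun (_ : Fin (d + 1)) (_ : Tor (fine n M)) => (1 : Matrix ι ι ℝ)) * cGreen M n (fun (_ : Fin (d + 1)) (_ : Tor (fine n M)) => (1 : Matrix ι ι ℝ)) a)) (fun y y' => CD * Real.exp (-(δ * tdistT M y y'))))
    (hδD : HasMaj (BlockNorm.ofBlocks (unitTorusGeo L k M) (liftBlk (blockOf n M) ι)) (BlockNorm.ofBlocks (unitTorusGeo L k M) (liftBlk (fun b : Tor (fine n M) × Fin (d + 1) => blockOf n M b.1) ι)) (Matrix.mulVecLin (cgrad M n T * cGreen M n T a - cgrad M n (fun (_ : Fin (d + 1)) (_ : Tor (fine n M)) => (1 : Matrix ι ι ℝ)) * cGreen M n (fun (_ : Fin (d + 1)) (_ : Tor (fine n M)) => (1 : Matrix ι ι ℝ)) a)) (fun y y' => PD * Real.exp (-(δ * tdistT M y y'))))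
    (hGT : HasMaj (BlockNorm.ofBlocks (unitTorusGeo L k M) (liftBlk (blockOf n M) ι)) (BlockNorm.ofBlocks (unitTorusGeo L k M) (liftBlk (blockOf n M) ι)) (Matrix.mulVecLin (cGreen M n T a)) (fun y y' => CT * Real.exp (-(δT * tdistT M y y')))) :
    HasMaj (BlockNorm.ofBlocks (unitTorusGeo L k M) (liftBlk (blockOf n M) ι)) (BlockNorm.ofBlocks (unitTorusGeo L k M) (liftBlk (blockOf n M) ι)) (Matrix.mulVecLin (cGreen M n T a - cGreen M n (fun (_ : Fin (d + 1)) (_ : Tor (fine n M)) => (1 : Matrix ι ι ℝ)) a))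
      (fun y y' => (CG * ((n : ℝ) * ((d + 1 : ℕ) * ρ) * Real.exp δ) * c * (CD + PD) * c + CA * ((n : ℝ) * ρ * Real.exp (δT + s) * CT * c) * c +
        |a| * (CG * (((n : ℝ) ^ (d + 1))⁻¹ * σ * (τ * CT)) * c) + |a| * (CG * (((n : ℝ) ^ (d + 1))⁻¹ * 1 * (σ * CT)) * c)) * Real.exp (-(δT * tdistT M y y'))) := by
  have hn : (0 : ℝ) < (n : ℝ) ^ (d + 1) := pow_pos (Nat.cast_pos.mpr (Nat.pos_of_ne_zero (NeZero.ne n))) _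
  have hδ : 0 ≤ δ := by linarith
  have htri := triangle254_unitTorusGeo L k M
  have hd := unitTorusGeo_dist_nonneg L k M
  have h1unit : ∀ (ν : Fin (d + 1)) (x : Tor (fine n M)), IsUnit ((fun (_ : Fin (d + 1)) (_ : Tor (fine n M)) => (1 : Matrix ι ι ℝ)) ν x) := fun _ _ => isUnit_one
  have hκS : (BlockNorm.ofBlocks (unitTorusGeo L k M) (liftBlk (blockOf n M) ι)).κ = 1 := kappa_ofBlocks _
  have hκV : (BlockNorm.ofBlocks (unitTorusGeo L k M) (liftBlk (fun b : Tor (fine n M) × Fin (d + 1) => blockOf n M b.1) ι)).κ = 1 := kappa_ofBlocks _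
  have hκC : (BlockNorm.ofBlocks (unitTorusGeo L k M) (liftBlk (fun y : Tor M => y) ι)).κ = 1 := kappa_ofBlocks _
  -- local rows
  have hDDt := hasMaj_cgrad_sub_transpose M n L k T hρ0 hδ hρc
  have hDD := hasMaj_cgrad_sub M n L k T hρ0 (by linarith : 0 ≤ δT + s) hρr
  have hQQ := hasMaj_csavg_sub M n L k T hσ0 hσr
  have hQQt := hasMaj_csavg_sub_transpose M n L k T hσ0 hσc
  have hQ := hasMaj_csavg M n L k T hτ0 hτr
  have hQ1t := hasMaj_csavg_transpose M n L k (fun (_ : Fin (d + 1)) (_ : Tor (fine n M)) => (1 : Matrix ι ι ℝ)) zero_le_one (stair_one_cols M n)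
  -- the gradient row at `T`
  have hDT : HasMaj (BlockNorm.ofBlocks (unitTorusGeo L k M) (liftBlk (blockOf n M) ι)) (BlockNorm.ofBlocks (unitTorusGeo L k M) (liftBlk (fun b : Tor (fine n M) × Fin (d + 1) => blockOf n M b.1) ι)) (Matrix.mulVecLin (cgrad M n T * cGreen M n T a)) (fun y y' => (CD + PD) * Real.exp (-(δ * tdistT M y y'))) := by
    rw [cgrad_mul_cGreen_eq_add M n T (fun (_ : Fin (d + 1)) (_ : Tor (fine n M)) => (1 : Matrix ι ι ℝ)) a, Matrix.mulVecLin_add]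
    exact (hD1.add hδD).mono fun y y' => le_of_eq (by ring)
  -- word 1: `G′(1)(D_T − ∂)ᵀ·(D_TG′(T))` at rate `δ − 2s`, lowered to `δ_T`
  have hin1 := hasMaj_comp_exp (ρ := δ - s) htri hd hrow hCG (by positivity) (by linarith) (by linarith) (by linarith) hG1 hDDt
  have hw1 : HasMaj (BlockNorm.ofBlocks (unitTorusGeo L k M) (liftBlk (blockOf n M) ι)) (BlockNorm.ofBlocks (unitTorusGeo L k M) (liftBlk (blockOf n M) ι)) (Matrix.mulVecLin (cGreen M n (fun (_ : Fin (d + 1)) (_ : Tor (fine n M)) => (1 : Matrix ι ι ℝ)) a * (cgrad M n T - cgrad M n (fun (_ : Fin (d + 1)) (_ : Tor (fine n M)) => (1 : Matrix ι ι ℝ)))ᵀ * (cgrad M n T * cGreen M n T a)))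
      (fun y y' => (CG * ((n : ℝ) * ((d + 1 : ℕ) * ρ) * Real.exp δ) * c * (CD + PD) * c) * Real.exp (-(δT * tdistT M y y'))) := by
    rw [Matrix.mulVecLin_mul, Matrix.mulVecLin_mul]
    have h := hasMaj_comp_exp (ρ := δ - 2 * s) htri hd hrow (by rw [hκS]; positivity) (by positivity) (by linarith) (by linarith) (by linarith) hin1 hDT
    refine (h.mono fun y y' => le_of_eq ?_).of_rate_le hd (by positivity) (by linarith : δT ≤ δ - 2 * s)
    rw [hκS, hκV]; ring
  -- word 2: `G′(1)∂ᵀ·((D_T − ∂)G′(T))` at rate `δ_T`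
  have hin2 := hasMaj_comp_exp (ρ := δT) htri hd hrow (by positivity) hCT hδT le_rfl (by linarith) hDD hGT
  have hw2 : HasMaj (BlockNorm.ofBlocks (unitTorusGeo L k M) (liftBlk (blockOf n M) ι)) (BlockNorm.ofBlocks (unitTorusGeo L k M) (liftBlk (blockOf n M) ι)) (Matrix.mulVecLin (cGreen M n (fun (_ : Fin (d + 1)) (_ : Tor (fine n M)) => (1 : Matrix ι ι ℝ)) a * (cgrad M n (fun (_ : Fin (d + 1)) (_ : Tor (fine n M)) => (1 : Matrix ι ι ℝ)))ᵀ * ((cgrad M n T - cgrad M n (fun (_ : Fin (d + 1)) (_ : Tor (fine n M)) => (1 : Matrix ι ι ℝ))) * cGreen M n T a)))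
      (fun y y' => (CA * ((n : ℝ) * ρ * Real.exp (δT + s) * CT * c) * c) * Real.exp (-(δT * tdistT M y y'))) := by
    rw [Matrix.mulVecLin_mul (cGreen M n (fun (_ : Fin (d + 1)) (_ : Tor (fine n M)) => (1 : Matrix ι ι ℝ)) a * (cgrad M n (fun (_ : Fin (d + 1)) (_ : Tor (fine n M)) => (1 : Matrix ι ι ℝ)))ᵀ) ((cgrad M n T - cgrad M n (fun (_ : Fin (d + 1)) (_ : Tor (fine n M)) => (1 : Matrix ι ι ℝ))) * cGreen M n T a),
      Matrix.mulVecLin_mul (cgrad M n T - cgrad M n (fun (_ : Fin (d + 1)) (_ : Tor (fine n M)) => (1 : Matrix ι ι ℝ))) (cGreen M n T a)]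
    have h := hasMaj_comp_exp (ρ := δT) htri hd hrow hCA (by rw [hκS]; positivity) hδT le_rfl (by linarith) hA1 hin2
    refine h.mono fun y y' => le_of_eq ?_
    rw [hκS, hκV]; ring
  -- word 3: `G′(1)(Q′(T) − Q′(1))ᵀ·(Q′(T)G′(T))`
  have hw3 : HasMaj (BlockNorm.ofBlocks (unitTorusGeo L k M) (liftBlk (blockOf n M) ι)) (BlockNorm.ofBlocks (unitTorusGeo L k M) (liftBlk (blockOf n M) ι)) (Matrix.mulVecLin (cGreen M n (fun (_ : Fin (d + 1)) (_ : Tor (fine n M)) => (1 : Matrix ι ι ℝ)) a * (csavg M n T - csavg M n (fun (_ : Fin (d + 1)) (_ : Tor (fine n M)) => (1 : Matrix ι ι ℝ)))ᵀ * (csavg M n T * cGreen M n T a)))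
      (fun y y' => (CG * (((n : ℝ) ^ (d + 1))⁻¹ * σ * (τ * CT)) * c) * Real.exp (-(δT * tdistT M y y'))) := by
    rw [Matrix.mulVecLin_mul, Matrix.mulVecLin_mul, Matrix.mulVecLin_mul]
    have hright := hasMaj_comp_localLeft hτ0 hQ hGT
    have hright' : HasMaj (BlockNorm.ofBlocks (unitTorusGeo L k M) (liftBlk (blockOf n M) ι)) (BlockNorm.ofBlocks (unitTorusGeo L k M) (liftBlk (fun y : Tor M => y) ι)) (Matrix.mulVecLin (csavg M n T) ∘ₗ Matrix.mulVecLin (cGreen M n T a)) (fun y y' => (τ * CT) * Real.exp (-(δT * tdistT M y y'))) :=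
      hright.mono fun y y' => le_of_eq (by rw [hκS]; ring)
    have hleft := hasMaj_comp_localRight hG1 hQQt fun y y' => by positivity
    have hleft' : HasMaj (BlockNorm.ofBlocks (unitTorusGeo L k M) (liftBlk (fun y : Tor M => y) ι)) (BlockNorm.ofBlocks (unitTorusGeo L k M) (liftBlk (blockOf n M) ι)) (Matrix.mulVecLin (cGreen M n (fun (_ : Fin (d + 1)) (_ : Tor (fine n M)) => (1 : Matrix ι ι ℝ)) a) ∘ₗ Matrix.mulVecLin (csavg M n T - csavg M n (fun (_ : Fin (d + 1)) (_ : Tor (fine n M)) => (1 : Matrix ι ι ℝ)))ᵀ) (fun y y' => (CG * (((n : ℝ) ^ (d + 1))⁻¹ * σ)) * Real.exp (-(δ * tdistT M y y'))) :=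
      hleft.mono fun y y' => le_of_eq (by rw [hκS]; ring)
    have h := hasMaj_comp_exp (ρ := δT) htri hd hrow (by positivity) (by positivity) hδT le_rfl (by linarith) hleft' hright'
    refine h.mono fun y y' => le_of_eq ?_
    rw [hκC]; ring
  -- word 4: `G′(1)Q′(1)ᵀ·((Q′(T) − Q′(1))G′(T))`
  have hw4 : HasMaj (BlockNorm.ofBlocks (unitTorusGeo L k M) (liftBlk (blockOf n M) ι)) (BlockNorm.ofBlocks (unitTorusGeo L k M) (liftBlk (blockOf n M) ι)) (Matrix.mulVecLin (cGreen M n (fun (_ : Fin (d + 1)) (_ : Tor (fine n M)) => (1 : Matrix ι ι ℝ)) a * (csavg M n (fun (_ : Fin (d + 1)) (_ : Tor (fine n M)) => (1 : Matrix ι ι ℝ)))ᵀ * ((csavg M n T - csavg M n (fun (_ : Fin (d + 1)) (_ : Tor (fine n M)) => (1 : Matrix ι ι ℝ))) * cGreen M n T a)))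
      (fun y y' => (CG * (((n : ℝ) ^ (d + 1))⁻¹ * 1 * (σ * CT)) * c) * Real.exp (-(δT * tdistT M y y'))) := by
    rw [Matrix.mulVecLin_mul, Matrix.mulVecLin_mul, Matrix.mulVecLin_mul]
    have hright := hasMaj_comp_localLeft hσ0 hQQ hGT
    have hright' : HasMaj (BlockNorm.ofBlocks (unitTorusGeo L k M) (liftBlk (blockOf n M) ι)) (BlockNorm.ofBlocks (unitTorusGeo L k M) (liftBlk (fun y : Tor M => y) ι)) (Matrix.mulVecLin (csavg M n T - csavg M n (fun (_ : Fin (d + 1)) (_ : Tor (fine n M)) => (1 : Matrix ι ι ℝ))) ∘ₗ Matrix.mulVecLin (cGreen M n T a)) (fun y y' => (σ * CT) * Real.exp (-(δT * tdistT M y y'))) :=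
      hright.mono fun y y' => le_of_eq (by rw [hκS]; ring)
    have hleft := hasMaj_comp_localRight hG1 hQ1t fun y y' => by positivity
    have hleft' : HasMaj (BlockNorm.ofBlocks (unitTorusGeo L k M) (liftBlk (fun y : Tor M => y) ι)) (BlockNorm.ofBlocks (unitTorusGeo L k M) (liftBlk (blockOf n M) ι)) (Matrix.mulVecLin (cGreen M n (fun (_ : Fin (d + 1)) (_ : Tor (fine n M)) => (1 : Matrix ι ι ℝ)) a) ∘ₗ Matrix.mulVecLin (csavg M n (fun (_ : Fin (d + 1)) (_ : Tor (fine n M)) => (1 : Matrix ι ι ℝ)))ᵀ) (fun y y' => (CG * (((n : ℝ) ^ (d + 1))⁻¹ * 1)) * Real.exp (-(δ * tdistT M y y'))) :=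
      hleft.mono fun y y' => le_of_eq (by rw [hκS]; ring)
    have h := hasMaj_comp_exp (ρ := δT) htri hd hrow (by positivity) (by positivity) hδT le_rfl (by linarith) hleft' hright'
    refine h.mono fun y y' => le_of_eq ?_
    rw [hκC]; ring
  -- assemble
  rw [cGreen_sub_words M n hT h1unit ha, mulVecLin_sub', mulVecLin_sub', mulVecLin_sub', mulVecLin_neg', mulVecLin_smul', mulVecLin_smul']
  have h3 := hasMaj_smul_ofBlocks (g := unitTorusGeo L k M) (liftBlk (blockOf n M) ι)
    (K := fun y y' => (CG * (((n : ℝ) ^ (d + 1))⁻¹ * σ * (τ * CT)) * c) * Real.exp (-(δT * tdistT M y y'))) (fun y y' => by positivity) a hw3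
  have h4 := hasMaj_smul_ofBlocks (g := unitTorusGeo L k M) (liftBlk (blockOf n M) ι)
    (K := fun y y' => (CG * (((n : ℝ) ^ (d + 1))⁻¹ * 1 * (σ * CT)) * c) * Real.exp (-(δT * tdistT M y y'))) (fun y y' => by positivity) a hw4
  refine (((hw1.neg.sub hw2).sub h3).sub h4).mono fun y y' => le_of_eq ?_
  ring

end GreenSub

/-! ## §2 `(Q′G′²Q′ᵀ)⁻¹(T)` -/

section SopInv

/-- ★★ **THE ROW OF `(Q′G′²Q′ᵀ)⁻¹(T)` FROM THE FLAT ONE** by the Neumann series over n15-c∕212's fixed point `S(T)⁻¹ = S(1)⁻¹ − S(1)⁻¹(S(T) − S(1))·S(T)⁻¹`: with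
`(Q′G′²Q′ᵀ)⁻¹(1) ≤ C_S n^{d+1}e^{−δ₁d}`, a row `B·n^{−(d+1)}·e^{−(δ₁−s)d}` of `S(T) − S(1)` and `C_SBc² < 1`: `(Q′G′²Q′ᵀ)⁻¹(T) ≤ C_S n^{d+1}(1 − C_SBc²)⁻¹e^{−(δ₁−2s)d}` (the a-priori bound
is automatic on the finite lattice). [cite: Balaban1985BackgroundPropagators, Thm 3.2 (3.48) p.398, Thm 3.4 p.400 («(Q′(U)G′²(U)Q′*(U))⁻¹ … extend … as analytic functions»); Balaban1985Variational, (188) p.308] -/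
theorem hasMaj_cSop_inv_of_flat {T : Fin (d + 1) → Tor (fine n M) → Matrix ι ι ℝ} (hT : ∀ ν x, IsUnit (T ν x)) {a : ℝ} (ha : 0 < a)
    {δ₁ s c CS B : ℝ} (hs : 0 < s) (hsδ : 2 * s ≤ δ₁) (hrow : RowSum (unitTorusGeo L k M) s c) (hc : 0 ≤ c) (hCS : 0 ≤ CS) (hB : 0 ≤ B)
    (hS1 : HasMaj (BlockNorm.ofBlocks (unitTorusGeo L k M) (liftBlk (fun y : Tor M => y) ι)) (BlockNorm.ofBlocks (unitTorusGeo L k M) (liftBlk (fun y : Tor M => y) ι)) (Matrix.mulVecLin (cSop M n (fun (_ : Fin (d + 1)) (_ : Tor (fine n M)) => (1 : Matrix ι ι ℝ)) a)⁻¹) (fun y y' => CS * (n : ℝ) ^ (d + 1) * Real.exp (-(δ₁ * tdistT M y y'))))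
    (hδS : HasMaj (BlockNorm.ofBlocks (unitTorusGeo L k M) (liftBlk (fun y : Tor M => y) ι)) (BlockNorm.ofBlocks (unitTorusGeo L k M) (liftBlk (fun y : Tor M => y) ι)) (Matrix.mulVecLin (cSop M n T a - cSop M n (fun (_ : Fin (d + 1)) (_ : Tor (fine n M)) => (1 : Matrix ι ι ℝ)) a)) (fun y y' => B * ((n : ℝ) ^ (d + 1))⁻¹ * Real.exp (-((δ₁ - s) * tdistT M y y'))))
    (hq : CS * B * c * c < 1) :
    HasMaj (BlockNorm.ofBlocks (unitTorusGeo L k M) (liftBlk (fun y : Tor M => y) ι)) (BlockNorm.ofBlocks (unitTorusGeo L k M) (liftBlk (fun y : Tor M => y) ι)) (Matrix.mulVecLin (cSop M n T a)⁻¹) (fun y y' => CS * (n : ℝ) ^ (d + 1) * (1 - CS * B * c * c)⁻¹ * Real.exp (-((δ₁ - 2 * s) * tdistT M y y'))) := by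
  have hn : (0 : ℝ) < (n : ℝ) ^ (d + 1) := pow_pos (Nat.cast_pos.mpr (Nat.pos_of_ne_zero (NeZero.ne n))) _
  have htri := triangle254_unitTorusGeo L k M
  have hd := unitTorusGeo_dist_nonneg L k M
  have h1unit : ∀ (ν : Fin (d + 1)) (x : Tor (fine n M)), IsUnit ((fun (_ : Fin (d + 1)) (_ : Tor (fine n M)) => (1 : Matrix ι ι ℝ)) ν x) := fun _ _ => isUnit_one
  have hκC : (BlockNorm.ofBlocks (unitTorusGeo L k M) (liftBlk (fun y : Tor M => y) ι)).κ = 1 := kappa_ofBlocks _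
  -- the small operator `K′ = −S(1)⁻¹(S(T) − S(1))` at rate `δ₁ − s`
  have hK0 := hasMaj_comp_exp (ρ := δ₁ - s) htri hd hrow (by positivity) (by positivity) (by linarith) (by linarith) (by linarith) hS1 hδS
  have hK : HasMaj (BlockNorm.ofBlocks (unitTorusGeo L k M) (liftBlk (fun y : Tor M => y) ι)) (BlockNorm.ofBlocks (unitTorusGeo L k M) (liftBlk (fun y : Tor M => y) ι)) (Matrix.mulVecLin (-((cSop M n (fun (_ : Fin (d + 1)) (_ : Tor (fine n M)) => (1 : Matrix ι ι ℝ)) a)⁻¹ * (cSop M n T a - cSop M n (fun (_ : Fin (d + 1)) (_ : Tor (fine n M)) => (1 : Matrix ι ι ℝ)) a))))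
      (fun y y' => (CS * B * c) * Real.exp (-((δ₁ - s) * tdistT M y y'))) := by
    rw [mulVecLin_neg', Matrix.mulVecLin_mul]
    refine hK0.neg.mono fun y y' => le_of_eq ?_
    rw [hκC]; field_simp
  have hS := hS1.of_rate_le hd (by positivity) (by linarith : δ₁ - 2 * s ≤ δ₁)
  have hfix : Matrix.mulVecLin (cSop M n T a)⁻¹ = Matrix.mulVecLin (cSop M n (fun (_ : Fin (d + 1)) (_ : Tor (fine n M)) => (1 : Matrix ι ι ℝ)) a)⁻¹ +
      Matrix.mulVecLin (-((cSop M n (fun (_ : Fin (d + 1)) (_ : Tor (fine n M)) => (1 : Matrix ι ι ℝ)) a)⁻¹ * (cSop M n T a - cSop M n (fun (_ : Fin (d + 1)) (_ : Tor (fine n M)) => (1 : Matrix ι ι ℝ)) a))) ∘ₗ Matrix.mulVecLin (cSop M n T a)⁻¹ := by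
    rw [← Matrix.mulVecLin_mul, ← Matrix.mulVecLin_add]
    exact congrArg Matrix.mulVecLin (cSop_inv_fixedPoint M n hT h1unit ha)
  obtain ⟨M₀, hM₀, hap⟩ := exists_const_hasMaj_ofBlocks (g := unitTorusGeo L k M) (liftBlk (fun y : Tor M => y) ι) (liftBlk (fun y : Tor M => y) ι) (Matrix.mulVecLin (cSop M n T a)⁻¹)
  have hq' : (BlockNorm.ofBlocks (unitTorusGeo L k M) (liftBlk (fun y : Tor M => y) ι)).κ * (CS * B * c) * c < 1 := by rw [hκC, one_mul]; exact hq
  have key := neumann_majorant (ρ := δ₁ - 2 * s) htri hd hrow (by positivity) (by positivity) hM₀ (by linarith) (by linarith) hK hS hfix hap hq'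
  refine key.mono fun y y' => le_of_eq ?_
  rw [hκC, one_mul]

end SopInv

end Summit.QuantumFields.YangMills.BalabanUVNodes.N15.CovLandau

end
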